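import Mathlib
import Literature.Combinatorics.Optimization.PathDecomposableMulticuts
import HarnessLib

/-!
# Locally consistent `±1` processes from multicut distributions (Charikar–Makarychev–Makarychev
# 2009, Corollary 5.1, in correlation-matrix form)

[topic Combinatorics/Optimization]

Sixth file of the formalisation of the Charikar–Makarychev–Makarychev Sherali–Adams gap for MAX-CUT.
CMM09 Corollary 5.1 (p. 9):

> "Suppose `G = (V,E)` is an `l`-path decomposable graph. Let `L = ⌊l/9⌋`; `µ ∈ [1/L, 1]`. Every
> vertex is assigned a random variable `X_u`; the random variables `X_u` take values `±1`; there
> exists random multicuts `S` that satisfy condition of Theorem 2.4 such that for every `u` and `v`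
> random variables `X_u` and `X_v` restricted to the event '`S` separates `u` and `v`' are
> independent; for every `u` and `v` random variables `X_u` and `X_v` restricted to the event '`S`
> does not separate `u` and `v`' satisfy `X_u = (−1)^{d_G(u,v)} X_v`. Proof. By Theorem 2.4, there
> exists a distribution of multicuts such that each piece is a tree. Given `S`, on every tree `T`
> choose one of the two proper 2-colourings at random."

What the proof of Theorem 5.3 uses of this process is its matrix of pair correlations
`E[X_u X_v]`, which is positive semidefinite on every finite set (it is the second-moment matrix of a
random vector) and has the printed values.  We formalise exactly that: for a good multicut
distribution `p` on `E` (`GoodMulticut µ L E p` of the previous file),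

* `corr p E u v = Σ_S p(S)·[u ~ v in E∖S]·(−1)^{d_{E∖S}(u,v)}` (the conditional expectation of
  `X_u X_v`: `0` on "separated" by independence of the colourings of distinct trees, the sign of the
  tree distance otherwise);
* `corr_posSemidef`: `(corr p E)|_T` is positive semidefinite for every `T` — proved from "each piece
  is a tree": a forest is properly 2-coloured (`IsAcyclic.coloringTwo`), so
  `[u~v](−1)^{d(u,v)} = [u~v]·s_u s_v`, and `Σ x_u x_v [u~v] s_u s_v = Σ_w r_w (Σ_{u~w} s_u x_u)² ≥ 0`;
* `corr_eq_of_edist_le`: `d_E(u,v) = k ≤ L ⇒ corr = (−(1−µ))^k` (conditions 1 of Thm 2.4, both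
  clauses); `abs_corr_le_of_lt_edist`: `d_E(u,v) > L ⇒ |corr| ≤ (1−µ)^L` (condition 2);
  `corr_self = 1`, `|corr| ≤ 1`, symmetry.

Everything is proved; no named facts.

## References

* [CharikarMakarychevMakarychev2009] M. Charikar, K. Makarychev, Y. Makarychev, *Integrality gaps for
  Sherali–Adams relaxations*, STOC 2009, doi:10.1145/1536414.1536455; Cor. 5.1 (p. 9), Thm 2.4 (p. 5).
* [CharikarMakarychevMakarychev2010] M. Charikar, K. Makarychev, Y. Makarychev, *Local global
  tradeoffs in metric embeddings*, SIAM J. Comput. 39 (2010); Thm 3.3 (p. 16).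
-/

noncomputable section

open Finset SimpleGraph Matrix

namespace Literature.Combinatorics.Optimization

namespace Multicut

variable {V : Type*} [Fintype V] [DecidableEq V]

open Classical in
/-- The conditional correlation of the `±1` process given the surviving edge set `Z`:
`[u ~ v]·(−1)^{d_Z(u,v)}`. [cite: CharikarMakarychevMakarychev2009, Cor. 5.1 (p. 9)] -/
def scorr (Z : Finset (Sym2 V)) (u v : V) : ℝ :=
  if (gr Z).Reachable u v then (-1 : ℝ) ^ (gr Z).dist u v else 0

/-- **The pair-correlation kernel of the CMM `±1` process** driven by the multicut distribution
`p` on `E`: `E[X_u X_v] = Σ_S p(S) [u ~ v in E∖S] (−1)^{d_{E∖S}(u,v)}`.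
[cite: CharikarMakarychevMakarychev2009, Cor. 5.1 (p. 9)] -/
def corr (p : Finset (Sym2 V) → ℝ) (E : Finset (Sym2 V)) (u v : V) : ℝ := ∑ S, p S * scorr (E \ S) u v

/-- `|scorr| = [u ~ v]`. [cite: CharikarMakarychevMakarychev2009, Cor. 5.1 (p. 9)] -/
theorem abs_scorr (Z : Finset (Sym2 V)) (u v : V) : |scorr Z u v| = jind Z u v := by
  unfold scorr
  by_cases h : (gr Z).Reachable u v
  · rw [if_pos h, jind_of_reachable h, abs_pow, abs_neg, abs_one, one_pow]
  · rw [if_neg h, jind_of_not_reachable h, abs_zero]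

/-- `scorr` is symmetric. [cite: CharikarMakarychevMakarychev2009, Cor. 5.1 (p. 9)] -/
theorem scorr_comm (Z : Finset (Sym2 V)) (u v : V) : scorr Z u v = scorr Z v u := by
  unfold scorr
  rw [SimpleGraph.dist_comm]
  by_cases h : (gr Z).Reachable u v
  · rw [if_pos h, if_pos h.symm]
  · rw [if_neg h, if_neg fun h' => h h'.symm]

/-- `scorr u u = 1`. [cite: CharikarMakarychevMakarychev2009, Cor. 5.1 (p. 9)] -/
theorem scorr_self (Z : Finset (Sym2 V)) (u : V) : scorr Z u u = 1 := by
  unfold scorr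
  rw [if_pos (Reachable.refl u), SimpleGraph.dist_self, pow_zero]

/-- `corr` is symmetric. [cite: CharikarMakarychevMakarychev2009, Cor. 5.1 (p. 9)] -/
theorem corr_comm (p : Finset (Sym2 V) → ℝ) (E : Finset (Sym2 V)) (u v : V) :
    corr p E u v = corr p E v u := by
  unfold corr; exact Finset.sum_congr rfl fun S _ => by rw [scorr_comm]

/-- `corr u u = 1` for a probability vector `p`. [cite: CharikarMakarychevMakarychev2009, Cor. 5.1 (p. 9: "X_u take values ±1")] -/
theorem corr_self {p : Finset (Sym2 V) → ℝ} (hp : ∑ S, p S = 1) (E : Finset (Sym2 V)) (u : V) :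
    corr p E u u = 1 := by
  unfold corr
  rw [Finset.sum_congr rfl fun S _ => by rw [scorr_self, mul_one]]
  exact hp

/-- `|corr u v| ≤ Pr[u, v not separated]`. [cite: CharikarMakarychevMakarychev2009, Cor. 5.1 (p. 9)] -/
theorem abs_corr_le_jointProb {p : Finset (Sym2 V) → ℝ} (hp : ∀ S, 0 ≤ p S) (E : Finset (Sym2 V))
    (u v : V) : |corr p E u v| ≤ jointProb p E u v := by
  unfold corr jointProb
  refine (abs_sum_le_sum_abs _ _).trans (le_of_eq (Finset.sum_congr rfl fun S _ => ?_))
  rw [abs_mul, abs_of_nonneg (hp S), abs_scorr]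

/-- `|corr u v| ≤ 1`. [cite: CharikarMakarychevMakarychev2009, Cor. 5.1 (p. 9)] -/
theorem abs_corr_le_one {p : Finset (Sym2 V) → ℝ} (hp : ∀ S, 0 ≤ p S) (hp1 : ∑ S, p S = 1)
    (E : Finset (Sym2 V)) (u v : V) : |corr p E u v| ≤ 1 := by
  refine (abs_corr_le_jointProb hp E u v).trans ?_
  calc jointProb p E u v ≤ ∑ S, p S * 1 :=
        Finset.sum_le_sum fun S _ => mul_le_mul_of_nonneg_left (jind_le_one _ _ _) (hp S)
    _ = 1 := by simp [hp1]

/-! ### The printed values -/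

/-- **Condition 1 of Thm 2.4 gives `E[X_u X_v] = (−(1−µ))^{d(u,v)}` for `d(u,v) ≤ L`** (on "not
separated" the unique shortest path survives, so `d_{E∖S} = d_E`).
[cite: CharikarMakarychevMakarychev2009, Cor. 5.1 (p. 9) with Thm 2.4(1) (p. 5)] -/
theorem corr_eq_of_edist_le {μ : ℝ} {L : ℕ} {E : Finset (Sym2 V)} {p : Finset (Sym2 V) → ℝ}
    (hG : GoodMulticut μ L E p) {u v : V} {k : ℕ} (hk : (gr E).edist u v = k) (hkL : k ≤ L) :
    corr p E u v = (-(1 - μ)) ^ k := by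
  have hterm : ∀ S, p S ≠ 0 → scorr (E \ S) u v = (-1 : ℝ) ^ k * jind (E \ S) u v := by
    intro S hS
    unfold scorr
    by_cases hr : (gr (E \ S)).Reachable u v
    · rw [if_pos hr, jind_of_reachable hr, mul_one]
      have hgeo := hG.geodesic S u v hS (by rw [hk]; exact_mod_cast hkL) hr
      have hd : (gr (E \ S)).dist u v = k := by
        have := Reachable.coe_dist_eq_edist hr
        rw [hgeo, hk] at this
        exact_mod_cast this
      rw [hd]
    · rw [if_neg hr, jind_of_not_reachable hr, mul_zero]
  unfold corr
  have hsum : ∑ S, p S * scorr (E \ S) u v = ∑ S, (-1 : ℝ) ^ k * (p S * jind (E \ S) u v) := by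
    refine Finset.sum_congr rfl fun S _ => ?_
    by_cases hS : p S = 0
    · rw [hS]; ring
    · rw [hterm S hS]; ring
  rw [hsum, ← Finset.mul_sum, show ∑ S, p S * jind (E \ S) u v = jointProb p E u v from rfl,
    hG.exact u v k hk hkL, neg_pow (1 - μ) k]

/-- **Condition 2 of Thm 2.4 gives `|E[X_u X_v]| ≤ (1−µ)^L` for `d(u,v) > L`.**
[cite: CharikarMakarychevMakarychev2009, Cor. 5.1 (p. 9) with Thm 2.4(2) (p. 5)] -/
theorem abs_corr_le_of_lt_edist {μ : ℝ} {L : ℕ} {E : Finset (Sym2 V)} {p : Finset (Sym2 V) → ℝ}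
    (hG : GoodMulticut μ L E p) {u v : V} (hfar : (L : ℕ∞) < (gr E).edist u v) :
    |corr p E u v| ≤ (1 - μ) ^ L :=
  (abs_corr_le_jointProb hG.nonneg E u v).trans (hG.far u v hfar)

/-! ### Positive semidefiniteness ("on every tree choose one of the two 2-colourings at random") -/

/-- **On a forest the conditional correlation factorises through a `±1` sign**:
`[u~v](−1)^{d(u,v)} = [u~v]·s_u·s_v` for a proper 2-colouring `s`.
[cite: CharikarMakarychevMakarychev2009, Cor. 5.1 proof (p. 9)] -/
theorem exists_sign_of_isAcyclic {Z : Finset (Sym2 V)} (hZ : (gr Z).IsAcyclic) :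
    ∃ s : V → ℝ, ∀ u v, scorr Z u v = jind Z u v * (s u * s v) := by
  classical
  let c : (gr Z).Coloring Bool := recolorOfEquiv _ finTwoEquiv hZ.coloringTwo
  refine ⟨fun u => if c u then 1 else -1, fun u v => ?_⟩
  unfold scorr
  by_cases hr : (gr Z).Reachable u v
  · rw [if_pos hr, jind_of_reachable hr, one_mul]
    obtain ⟨w, hw⟩ := Reachable.exists_walk_length_eq_dist hr
    have hpar := c.even_length_iff_congr w
    rw [hw] at hpar
    by_cases he : Even ((gr Z).dist u v)
    · rw [he.neg_one_pow]
      have hc : (c u ↔ c v) := hpar.1 he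
      by_cases hu : c u
      · have hv : c v = true := hc.1 hu
        simp [hu, hv]
      · have hv : ¬ c v = true := fun h => hu (hc.2 h)
        simp [hu, hv]
    · rw [(Nat.not_even_iff_odd.1 he).neg_one_pow]
      have hc : ¬ (c u ↔ c v) := fun h => he (hpar.2 h)
      by_cases hu : c u
      · have hv : ¬ c v = true := fun h => hc ⟨fun _ => h, fun _ => hu⟩
        simp [hu, hv]
      · have hv : c v = true := by
          by_contra h
          exact hc ⟨fun h' => absurd h' hu, fun h' => absurd h' h⟩
        simp [hu, hv]
  · rw [if_neg hr, jind_of_not_reachable hr, zero_mul]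

/-- **The reachability kernel of any graph is positive semidefinite**: for `x` supported on a finite
set `T`, `Σ_{i,j∈T} x_i x_j [i~j] = Σ_{w∈T} |cls_T(w)|⁻¹ (Σ_{i∈T, i~w} x_i)² ≥ 0`.
[cite: CharikarMakarychevMakarychev2009, Cor. 5.1 proof (p. 9)] -/
theorem sum_sum_jind_nonneg (Z : Finset (Sym2 V)) (T : Finset V) (y : V → ℝ) :
    0 ≤ ∑ i ∈ T, ∑ j ∈ T, y i * y j * jind Z i j := by
  classical
  -- equivalence classes inside `T`
  let C : V → Finset V := fun i => T.filter fun w => (gr Z).Reachable i w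
  have hC : ∀ i w, w ∈ C i → C w = C i := by
    intro i w hw
    have hiw : (gr Z).Reachable i w := (mem_filter.1 hw).2
    ext z
    simp only [C, mem_filter]
    exact ⟨fun ⟨hz, h⟩ => ⟨hz, hiw.trans h⟩, fun ⟨hz, h⟩ => ⟨hz, hiw.symm.trans h⟩⟩
  let r : V → ℝ := fun w => 1 / (C w).card
  -- `[i~j] = Σ_{w∈T} r_w [w~i][w~j]` for `i ∈ T`
  have key : ∀ i ∈ T, ∀ j, jind Z i j = ∑ w ∈ T, r w * (jind Z w i * jind Z w j) := by
    intro i hi j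
    have hiC : i ∈ C i := mem_filter.2 ⟨hi, Reachable.refl _⟩
    rw [← Finset.sum_filter_add_sum_filter_not T (fun w => (gr Z).Reachable i w)]
    have h0 : ∑ w ∈ T.filter (fun w => ¬ (gr Z).Reachable i w), r w * (jind Z w i * jind Z w j) = 0 :=
      Finset.sum_eq_zero fun w hw => by
        rw [jind_of_not_reachable (fun h => (mem_filter.1 hw).2 h.symm), zero_mul, mul_zero]
    rw [h0, add_zero]
    by_cases hij : (gr Z).Reachable i j
    · rw [jind_of_reachable hij]
      have : ∀ w ∈ C i, r w * (jind Z w i * jind Z w j) = 1 / (C i).card := by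
        intro w hw
        have hiw : (gr Z).Reachable i w := (mem_filter.1 hw).2
        rw [jind_of_reachable hiw.symm, jind_of_reachable (hiw.symm.trans hij), mul_one, mul_one]
        show 1 / ((C w).card : ℝ) = 1 / (C i).card
        rw [hC i w hw]
      rw [Finset.sum_congr rfl this, Finset.sum_const, nsmul_eq_mul]
      have hpos : (0 : ℝ) < (C i).card := by exact_mod_cast Finset.card_pos.2 ⟨i, hiC⟩
      field_simp
    · rw [jind_of_not_reachable hij]
      refine (Finset.sum_eq_zero fun w hw => ?_).symm
      have hiw : (gr Z).Reachable i w := (mem_filter.1 hw).2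
      rw [jind_of_not_reachable (fun h => hij (hiw.trans h)), mul_zero, mul_zero]
  -- rewrite the quadratic form as a sum of squares
  have hsq : ∑ i ∈ T, ∑ j ∈ T, y i * y j * jind Z i j =
      ∑ w ∈ T, r w * (∑ i ∈ T, jind Z w i * y i) ^ 2 := by
    calc ∑ i ∈ T, ∑ j ∈ T, y i * y j * jind Z i j
        = ∑ i ∈ T, ∑ j ∈ T, ∑ w ∈ T, y i * y j * (r w * (jind Z w i * jind Z w j)) := by
          refine Finset.sum_congr rfl fun i hi => Finset.sum_congr rfl fun j _ => ?_
          rw [key i hi j, Finset.mul_sum]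
      _ = ∑ i ∈ T, ∑ w ∈ T, ∑ j ∈ T, y i * y j * (r w * (jind Z w i * jind Z w j)) :=
          Finset.sum_congr rfl fun i _ => Finset.sum_comm
      _ = ∑ w ∈ T, ∑ i ∈ T, ∑ j ∈ T, y i * y j * (r w * (jind Z w i * jind Z w j)) := Finset.sum_comm
      _ = ∑ w ∈ T, r w * (∑ i ∈ T, jind Z w i * y i) ^ 2 := by
          refine Finset.sum_congr rfl fun w _ => ?_
          rw [sq, Finset.sum_mul_sum, Finset.mul_sum]
          refine Finset.sum_congr rfl fun i _ => ?_
          rw [Finset.mul_sum]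
          refine Finset.sum_congr rfl fun j _ => ?_
          ring
  rw [hsq]
  exact Finset.sum_nonneg fun w _ => mul_nonneg (by positivity) (sq_nonneg _)

/-- **Corollary 5.1, matrix form (all vertices): the correlation kernel of the `±1` process is
positive semidefinite.** [cite: CharikarMakarychevMakarychev2009, Cor. 5.1 (p. 9)] -/
theorem corr_posSemidef_univ {μ : ℝ} {L : ℕ} {E : Finset (Sym2 V)} {p : Finset (Sym2 V) → ℝ}
    (hG : GoodMulticut μ L E p) : (Matrix.of fun u v : V => corr p E u v).PosSemidef := by
  classical
  refine Matrix.PosSemidef.of_dotProduct_mulVec_nonneg ?_ fun x => ?_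
  · exact Matrix.IsHermitian.ext fun i j => by simp only [of_apply, star_trivial]; exact corr_comm _ _ _ _
  have hform : star x ⬝ᵥ ((Matrix.of fun u v : V => corr p E u v) *ᵥ x) =
      ∑ i, ∑ j, x i * x j * corr p E i j := by
    simp only [star_trivial, dotProduct, mulVec, of_apply, Finset.mul_sum]
    refine Finset.sum_congr rfl fun i _ => Finset.sum_congr rfl fun j _ => ?_
    ring
  rw [hform]
  -- expand `corr` and move the sum over multicuts outside
  have hswap : ∑ i, ∑ j, x i * x j * corr p E i j =
      ∑ S, p S * ∑ i, ∑ j, x i * x j * scorr (E \ S) i j := by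
    calc ∑ i, ∑ j, x i * x j * corr p E i j
        = ∑ i, ∑ j, ∑ S, p S * (x i * x j * scorr (E \ S) i j) := by
          refine Finset.sum_congr rfl fun i _ => Finset.sum_congr rfl fun j _ => ?_
          rw [corr, Finset.mul_sum]
          exact Finset.sum_congr rfl fun S _ => by ring
      _ = ∑ i, ∑ S, ∑ j, p S * (x i * x j * scorr (E \ S) i j) :=
          Finset.sum_congr rfl fun i _ => Finset.sum_comm
      _ = ∑ S, ∑ i, ∑ j, p S * (x i * x j * scorr (E \ S) i j) := Finset.sum_comm
      _ = ∑ S, p S * ∑ i, ∑ j, x i * x j * scorr (E \ S) i j := by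
          refine Finset.sum_congr rfl fun S _ => ?_
          rw [Finset.mul_sum]
          exact Finset.sum_congr rfl fun i _ => by rw [Finset.mul_sum]
  rw [hswap]
  refine Finset.sum_nonneg fun S _ => ?_
  by_cases hS : p S = 0
  · rw [hS, zero_mul]
  refine mul_nonneg (hG.nonneg S) ?_
  obtain ⟨s, hs⟩ := exists_sign_of_isAcyclic (hG.acyclic S hS)
  have : ∑ i, ∑ j, x i * x j * scorr (E \ S) i j =
      ∑ i ∈ (univ : Finset V), ∑ j ∈ (univ : Finset V), (x i * s i) * (x j * s j) * jind (E \ S) i j :=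
    Finset.sum_congr rfl fun i _ => Finset.sum_congr rfl fun j _ => by rw [hs]; ring
  rw [this]
  exact sum_sum_jind_nonneg (E \ S) univ (fun v => x v * s v)

/-- **Corollary 5.1, matrix form: the correlation kernel restricted to any finite vertex set `T`
is a positive semidefinite matrix** (the shape consumed by the Gram-matrix step of Thm 5.2).
[cite: CharikarMakarychevMakarychev2009, Cor. 5.1 (p. 9)] -/
theorem corr_posSemidef {μ : ℝ} {L : ℕ} {E : Finset (Sym2 V)} {p : Finset (Sym2 V) → ℝ}
    (hG : GoodMulticut μ L E p) (T : Finset V) :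
    (Matrix.of fun i j : ↥T => corr p E i.1 j.1).PosSemidef :=
  (corr_posSemidef_univ hG).submatrix (fun i : ↥T => i.1)

end Multicut

end Literature.Combinatorics.Optimization
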